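import Mathlib
import Literature.MathematicalPhysics.QuantumFieldTheory.Balaban1983to89.B6BondElimination

/-!
# `Balaban1983to89.B6AdjointAveraging` — the adjoint block averaging `Q₁*` of B5 (1.11) and the undisplayed step of
B6 p. 248, *"Taking into account that ‖B₁‖² is bounded from below by const‖B‖²"* (B₁ = Q″*B with the axial tree bonds
set to 0), PROVED with an explicit constant (cell census: closes item (iii) of the located objection GAPS G-B6-12).
v1.1 (docstring revision only; every declaration and proof byte-identical to v1): header (e) and the docstrings of
`coarse_sq_le` / `p248_lower` now say for WHICH identity-bond set E the hypothesis "no E-bond is a pivot" holds.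

B6 = T. Bałaban, *Propagators and renormalization transformations for lattice gauge theories. II*, Commun. Math.
Phys. **96**, 223–250 (1984) [Balaban1984PropagatorsII] (held `paper:balaban1984-cmp96-propagators-rt-ii`; journal
page = PDF page + 222).  B5 = T. Bałaban, *Propagators and renormalization transformations for lattice gauge
theories. I*, Commun. Math. Phys. **95**, 17–40 (1984) [Balaban1984PropagatorsI] (journal page = PDF page + 16).
Every quotation below was read from the x2 page renders `b2b-balaban-ref1/pages/1984-cmp96-propagators-rt-II/
…-p021,-p026-x2.png` (B6 pp. 243, 248) and the renders already cited in `…B6BondElimination` (B5 pp. 18–19, B6 pp.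
224, 249–250), not from an OCR layer.  No existing module is modified; this module imports `…B6BondElimination` (this
unit, p178288) for the bond geometry of (1.11) (`mult`, `pivSite`, `avgQ`, `IsTree`, `Admissible`) and its kernel
lemmas (`avgQ_eq_sum_mult`, `mult_pivSite`, `eq_of_mult_pivSite_ne_zero`, `not_isTree_of_piv`, `sum_mult_le_L`,
`sum_mult_le`).

CITATION HEADER (lean-in-tree rule 2026-08-18).  WHAT IS PRINTED (verbatim).
* B6 p. 243 (2.112): *"∫dB exp[−½a Σ_{b∈Λ^c} |B(b)|² − ½aL^{d−2} Σ_{c∈Λ′} |(Q₁B)(c)|²] Π_{y∈Λ′} δ_{Ax(y)}(B)"*; p. 243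
  after (2.119): *"where ½⟨Q″B, aQ″B⟩ is equal to the quadratic form in B in (2.112)."*
* B6 p. 248 (2.144) and after: *"⟨B, (QG_□Q*)↾_□B⟩ = (L^jη)^{d+2}⟨B, (QG^ξ_□Q*)↾_□B⟩ = (L^jη)^{d+2}⟨Q″*B,
  Q_jG^ξ_□Q_j*Q″*B⟩, (2.144) where Q″ is defined, as in (2.119), by the quadratic form in B in the expression (2.112),
  and the last scalar product above is on the unit scale. We put B equal to 0 outside □, and we omit the superscripts ξ
  and □ in the sequel."*
* B6 p. 248 (2.146)–(2.147): *"⟨B, QGQ*B⟩ = ⟨Q″*B, C̃^{(j)}_Λ Q″*B⟩ = ⟨B₁, C̃^{(j)}_Λ B₁⟩, (2.146) where B₁ is equal to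
  Q″*B everywhere except the bonds of ⋃_{y∈Λ′} Ax(y) at which it is equal to 0. The operator C̃^{(j)}_Λ is an inverse
  to the operator of the quadratic form (2.120), hence it is bounded from below by an inverse of an upper bound of this
  form. Taking into account that ‖B₁‖² is bounded from below by const‖B‖², we get ⟨B, (QG_□Q*)↾_□B⟩ ≥ γ₀‖B‖²
  (2.147) with a positive constant γ₀ depending on d and L only."*
* B5 (1.11) p. 19: *"(QA)_c = Σ_{x∈B(c₋)} L^{−(d+1)} A([x, x(c)])"* (typed verbatim as `B6BondElimination.avgQ`); B5
  (1.7), (1.10) pp. 18–19 (the contours Γ_{y,x} and the axial gauge conditions, typed as `B6BondElimination.IsTree` and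
  PROVED equal to the printed conditions in `B6BondElimination.tree_iff_axial`); B6 p. 224: *"If Ω ⊂ T_η, then we
  denote by Ω also the set of bounds ⋃_{x∈Ω} st(x) = {bonds b ⊂ T_η: at least one end-point of b belongs to Ω}"* (sic).

THE PRINTED STEP AND WHAT IS NOT DISPLAYED.  The sentence *"‖B₁‖² is bounded from below by const‖B‖²"* (p. 248) is
asserted without an argument or a value of the constant (census row G-B6-12 (iii): *"true with a constant depending on
d and L only — e.g. for each coarse bond the block-crossing fine bonds are in no axial tree and alone retain a fixed
L-dependent fraction of ‖Q″*B‖² — not displayed"*).  It is the second input of (2.147), whose output (2.148) is the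
input of Prop. 2.7 / Cor. 2.8 of B6, consumed by B9 Cor. 3.5.

THE READING (typed objects; every choice recorded in the cell's DIVERGENCE D-b06.12).
(a) By (2.112)/(2.119) the operator Q″ sends a unit-lattice bond field B to the pair (B↾_{Λ^c}, L^{(d−2)/2}(Q₁B)↾_{Λ′}):
    its adjoint for the unit-scale sums of (2.144) acts on a pair (F, B′) — F a field on a set E of unit bonds (print:
    E = the bonds of Λ^c), B′ a field on a set K of bonds of the L-lattice (print: K = the bonds of Λ′) — by
    Q″*(F, B′)(b) = 1_E(b)F(b) + w·(Q₁*B′)(b), w = L^{(d−2)/2}; we keep w a free real parameter (w ≠ 0).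
(b) Q₁* is the adjoint of (1.11) for unit sums: (Q₁*B′)(b) = L^{−(d+1)} Σ_{c∈K} mult_c(b) B′(c), mult_c(b) = the number
    of occurrences of the unit bond b in the double sum (1.11) for c (`B6BondElimination.mult`); typed as `adjQ` and
    PROVED adjoint to `avgQ` in `sum_mul_adjQ` (Σ_b B(b)(Q₁*B′)(b) = Σ_{c∈K} (Q₁B)(c) B′(c)) — so `adjQ` is not a
    reading but the adjoint of the verbatim (1.11).
(c) B₁ = Q″*(F, B′) with the value 0 on the axial tree bonds (`IsTree`, = the bonds of ⋃_{y∈Y} Ax(y) by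
    `B6BondElimination.isTree_iff`; print: Y = Λ′): `bOne`.
(d) The unit bonds are indexed, as in `…B6BondElimination`, by (starting point ∈ Ω, direction ∈ Fin d) for a finite
    Ω ⊂ Z^d containing the starting points of all bonds in play (B5 (1.1)); ‖·‖² = unit-scale sums of squares on
    each component (the two-scale weights of B6 (2.69) are not typed — they rescale w and the constant).
(e) Hypotheses: K admissible (c₋ ∈ LZ^d and the pivot b₀(c) — the last unit bond of c, B9 p. 428 — starts in Ω:
    `B6BondElimination.Admissible`); no bond of E is a tree bond (print: the trees Γ_{y,x} ⊂ B(y), y ∈ Λ′, consist of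
    bonds with both end-points in B(y) ⊂ Λ); no bond of E is a pivot.  WHICH E THIS IS (v1.1, docstring revision after
    the cell's hostile reading GAPS C-adv4-37 (f2) / NOTE adv4-g13): the last hypothesis holds for E = the unit bonds
    with BOTH end-points in Λ^c — the repaired interface convention recorded in the cell's GAPS G-adv8-12 (an interface
    bond is constrained at the coarser of its two scales only), the reading under which the cell found (2.120) positive
    on (2.121) (C-adv8-14) and re-derived (2.145)–(2.147) (C-adv4-37).  It does NOT hold for the bond sets of the
    PRINTED p. 224 convention (*"at least one end-point of b belongs to Ω"*): under it a unit bond with one end-point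
    in Λ and one in Λ^c is a bond of Λ AND of Λ^c, and the pivot b₀(c) = [c₊ − e_μ, c₊] of every constraint bond c
    with exactly one end-point in Λ′ is such an interface bond (c₋ ∈ Λ′ ∌ c₊: c₊ − e_μ ∈ B(c₋) ⊂ Λ, c₊ ∈ B(c₊) ⊂ Λ^c;
    c₋ ∉ Λ′ ∋ c₊: the mirror case), hence a bond of E = Λ^c as printed.  (v1 justified the hypothesis by *"b₀(c) … is
    a bond of Λ by the p. 224 convention"* — true, but not exclusive of E under that convention; corrected here.)  So
    `p248_lower` certifies the printed sentence for the repaired bond sets; for the printed ones the sentence is not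
    contested (the cell's C-adv4-37 (f2) locates the positivity in the tent bonds inside the Λ^c-block instead, with
    another constant) but it is NOT typed here.  Nothing else is assumed: in particular the bonds of E MAY occur in
    the sums (1.11) of the constraint bonds c with exactly one end-point in Λ′ (such a (Q₁B)(c) depends on unit bonds
    inside the Λ^c-block of c, which have both end-points in Λ^c) — the theorem tolerates this overlap.  On the
    normalisation of Q″ (which (2.119) fixes only through a quadratic form) see the cell's GAPS G-adv4-13: this module
    is its reading (γ) with the coarse weight w kept free, so readings (α)/(β) are covered after rescaling w.

KERNEL-CHECKED HERE (no `sorry`; axioms ⊆ {propext, Classical.choice, Quot.sound}).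
(1) `sum_sq_le` — the rectangular Schur test Σ_i (Σ_j T_{ij}x_j)² ≤ R·C·Σ_j x_j² (T ≥ 0, row sums ≤ R, column sums
    ≤ C) [folklore];
(2) `adjQ`, `sum_mul_adjQ` (adjointness to the verbatim (1.11)), `adjQ_piv` ((Q₁*B′)(b₀(c)) = L^{−d}B′(c): the pivot
    occurs L times in (1.11) for c and in no other constraint), `sum_adjQ_sq_le` (‖Q₁*B′‖² ≤ L^{−d}‖B′‖², from row sums
    ≤ L and column sums ≤ L^{d+1} of the multiplicities);
(3) `bOne` and the two halves `coarse_sq_le` ((w/L^d)²‖B′‖² ≤ ‖B₁‖²: distinct constraints have distinct pivots, pivots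
    are neither tree bonds nor E-bonds) and `ident_sq_le` (‖F‖² ≤ 2‖B₁‖² + 2w²L^{−d}‖B′‖²);
(4) the printed sentence with an explicit constant: `p248_lower` —
      ‖F↾_E‖² + ‖B′↾_K‖² ≤ (2 + 2L^d + L^{2d}/w²)·‖B₁‖²,
    i.e. ‖B₁‖² ≥ const‖B‖² with const = (2 + 2L^d + L^{2d}/w²)⁻¹, = (2 + 2L^d + L^{d+2})⁻¹ for the printed weight
    w² = L^{d−2}; depending on d and L only, uniformly in Ω, E, K, Y — as printed.

TYPING REMARKS.  (i) T^{(j)}-tori ↦ Z^d, finite Ω (as D-b04.5, D-b06.10, D-b06.11).  (ii) *"We put B equal to 0 outside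
□"* restricts the argument, not the inequality, which holds for all (F, B′).  (iii) The constant is not optimal (the
pivot alone is used on the coarse side); the print claims only existence.  (iv) The first inequality of (2.147) —
C̃^{(j)}_Λ ≥ (upper bound of (2.120))⁻¹ — and the two-scale encoding of □ (G-B6-12 (ii)) are not the subject of this
file.  Value = kernel certificate of one undisplayed elementary step, NOT summit progress.
-/

open Finset

namespace Literature.MathematicalPhysics.QuantumFieldTheory.Balaban1983to89.B6AdjointAveraging

/-! ## §1  The rectangular Schur test -/

section Schur

variable {ι κ : Type*} [Fintype κ]

/-- Row-wise Cauchy–Schwarz with non-negative weights: (Σ_j T_{ij}x_j)² ≤ (Σ_j T_{ij})·Σ_j T_{ij}x_j². [folklore] -/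
theorem row_sq_le (T : ι → κ → ℝ) (hT : ∀ i j, 0 ≤ T i j) (x : κ → ℝ) (i : ι) :
    (∑ j, T i j * x j) ^ 2 ≤ (∑ j, T i j) * ∑ j, T i j * x j ^ 2 := by
  have hcs := Finset.sum_mul_sq_le_sq_mul_sq (univ : Finset κ)
    (fun j => Real.sqrt (T i j)) (fun j => Real.sqrt (T i j) * x j)
  have e1 : ∀ j, Real.sqrt (T i j) * (Real.sqrt (T i j) * x j) = T i j * x j := by
    intro j; rw [← mul_assoc, Real.mul_self_sqrt (hT i j)]
  have e2 : ∀ j, Real.sqrt (T i j) ^ 2 = T i j := fun j => Real.sq_sqrt (hT i j)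
  have e3 : ∀ j, (Real.sqrt (T i j) * x j) ^ 2 = T i j * x j ^ 2 := by
    intro j; rw [mul_pow, Real.sq_sqrt (hT i j)]
  simp only [e1, e2, e3] at hcs
  exact hcs

/-- **Rectangular Schur test.**  If `T ≥ 0` has row sums ≤ R (R ≥ 0) and column sums ≤ C, then
‖Tx‖₂² ≤ R·C·‖x‖₂². [folklore] -/
theorem sum_sq_le [Fintype ι] (T : ι → κ → ℝ) (hT : ∀ i j, 0 ≤ T i j) (x : κ → ℝ) {R C : ℝ} (hR0 : 0 ≤ R)
    (hR : ∀ i, ∑ j, T i j ≤ R) (hC : ∀ j, ∑ i, T i j ≤ C) :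
    ∑ i, (∑ j, T i j * x j) ^ 2 ≤ R * C * ∑ j, x j ^ 2 := by
  calc ∑ i, (∑ j, T i j * x j) ^ 2
      ≤ ∑ i, (∑ j, T i j) * ∑ j, T i j * x j ^ 2 := Finset.sum_le_sum fun i _ => row_sq_le T hT x i
    _ ≤ ∑ i, R * ∑ j, T i j * x j ^ 2 := by
        refine Finset.sum_le_sum fun i _ => ?_
        exact mul_le_mul_of_nonneg_right (hR i) (Finset.sum_nonneg fun j _ => mul_nonneg (hT i j) (sq_nonneg _))
    _ = R * ∑ j, x j ^ 2 * ∑ i, T i j := by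
        rw [← Finset.mul_sum, Finset.sum_comm]
        congr 1
        refine Finset.sum_congr rfl fun j _ => ?_
        rw [Finset.mul_sum]
        refine Finset.sum_congr rfl fun i _ => ?_
        ring
    _ ≤ R * ∑ j, x j ^ 2 * C := by
        refine mul_le_mul_of_nonneg_left (Finset.sum_le_sum fun j _ => ?_) hR0
        exact mul_le_mul_of_nonneg_left (hC j) (sq_nonneg _)
    _ = R * C * ∑ j, x j ^ 2 := by rw [← Finset.sum_mul]; ring

end Schur

/-! ## §2  The adjoint averaging Q₁* -/

section AdjQ

open B6Elimination B6BondElimination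

variable {d : ℕ} {L : ℕ} {Ω : Finset (Fin d → ℤ)}

/-- Q₁*: the adjoint, for unit-scale sums, of the block averaging (1.11) *"(QA)_c = Σ_{x∈B(c₋)} L^{−(d+1)} A([x,
x(c)])"* restricted to the constraint bonds c ∈ K (print: the bonds of Λ′): (Q₁*B′)(b) = L^{−(d+1)} Σ_{c∈K} mult_c(b)
B′(c), where mult_c(b) is the number of occurrences of the unit bond b in the double sum (1.11) for c.  PROVED to be
the adjoint in `sum_mul_adjQ`. [cite: Balaban1984PropagatorsI, (1.11) p.19] -/
noncomputable def adjQ (L : ℕ) (K : Finset ((Fin d → ℤ) × Fin d)) (B' : (Fin d → ℤ) × Fin d → ℝ) (p : B4.Idx Ω d) : ℝ :=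
  ((L : ℝ) ^ (d + 1))⁻¹ * ∑ c ∈ K, (mult L c (p.1 : Fin d → ℤ) p.2 : ℝ) * B' c

variable {K : Finset ((Fin d → ℤ) × Fin d)}

/-- ADJOINTNESS: Σ_b B(b)·(Q₁*B′)(b) = Σ_{c∈K} (Q₁B)(c)·B′(c), with (Q₁B)(c) the verbatim (1.11) (`avgQ`, B extended
by zero outside the variables). [cite: Balaban1984PropagatorsI, (1.11) p.19] -/
theorem sum_mul_adjQ (B : B4.Idx Ω d → ℝ) (B' : (Fin d → ℤ) × Fin d → ℝ) :
    ∑ p, B p * adjQ L K B' p = ∑ c ∈ K, avgQ L B c * B' c := by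
  have h1 : ∀ p : B4.Idx Ω d, B p * adjQ L K B' p =
      ∑ c ∈ K, ((L : ℝ) ^ (d + 1))⁻¹ * ((mult L c (p.1 : Fin d → ℤ) p.2 : ℝ) * B p) * B' c := by
    intro p
    unfold adjQ
    rw [Finset.mul_sum, Finset.mul_sum]
    refine Finset.sum_congr rfl fun c _ => ?_
    ring
  rw [Finset.sum_congr rfl fun p _ => h1 p, Finset.sum_comm]
  refine Finset.sum_congr rfl fun c _ => ?_
  rw [avgQ_eq_sum_mult, Finset.mul_sum, Finset.sum_mul]

/-- AT THE PIVOT: (Q₁*B′)(b₀(c)) = L^{−d}B′(c) for c ∈ K ⊂ LZ^d-bonds — the pivot b₀(c) occurs L times in (1.11) for c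
(`mult_pivSite`) and in no other constraint (`eq_of_mult_pivSite_ne_zero`). [folklore] -/
theorem adjQ_piv (hL : 0 < L) (hK : ∀ c ∈ K, ∀ i, (L : ℤ) ∣ c.1 i) (B' : (Fin d → ℤ) × Fin d → ℝ)
    {c : (Fin d → ℤ) × Fin d} (hc : c ∈ K) (p : B4.Idx Ω d) (hp : (p.1 : Fin d → ℤ) = pivSite L c)
    (hμ : p.2 = c.2) : adjQ L K B' p = ((L : ℝ) ^ d)⁻¹ * B' c := by
  unfold adjQ
  rw [Finset.sum_eq_single_of_mem c hc]
  · rw [hp, hμ, mult_pivSite hL c]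
    have hL0 : (L : ℝ) ≠ 0 := by exact_mod_cast hL.ne'
    rw [pow_succ, mul_inv, mul_assoc, inv_mul_cancel_left₀ hL0]
  · intro c' hc' hne
    have h0 : mult L c' (p.1 : Fin d → ℤ) p.2 = 0 := by
      by_contra h
      rw [hp, hμ] at h
      exact hne (eq_of_mult_pivSite_ne_zero hL (hK c' hc') (hK c hc) h).symm
    rw [h0, Nat.cast_zero, zero_mul]

/-- SCHUR BOUND ‖Q₁*B′‖² ≤ L^{−d}‖B′‖²: the multiplicities have row sums Σ_{c∈K} mult_c(b) ≤ L (`sum_mult_le_L`, the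
blocks of the L-lattice are disjoint) and column sums Σ_b mult_c(b) ≤ L^{d+1} (`sum_mult_le`). [folklore] -/
theorem sum_adjQ_sq_le (hL : 0 < L) (hK : ∀ c ∈ K, ∀ i, (L : ℤ) ∣ c.1 i) (B' : (Fin d → ℤ) × Fin d → ℝ) :
    ∑ p : B4.Idx Ω d, adjQ L K B' p ^ 2 ≤ ((L : ℝ) ^ d)⁻¹ * ∑ c ∈ K, B' c ^ 2 := by
  have hL0 : (0 : ℝ) < L := by exact_mod_cast hL
  -- the multiplicity matrix on Idx Ω × ↥K
  set T : B4.Idx Ω d → ↥K → ℝ := fun p c => (mult L (c : (Fin d → ℤ) × Fin d) (p.1 : Fin d → ℤ) p.2 : ℝ) with hT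
  have hT0 : ∀ p c, 0 ≤ T p c := fun p c => by rw [hT]; exact Nat.cast_nonneg _
  have hrow : ∀ p : B4.Idx Ω d, ∑ c : ↥K, T p c ≤ (L : ℝ) := by
    intro p
    rw [hT]
    dsimp only
    rw [Finset.sum_coe_sort K (fun c => (mult L c (p.1 : Fin d → ℤ) p.2 : ℝ))]
    exact_mod_cast sum_mult_le_L hL hK (p.1 : Fin d → ℤ) p.2
  have hcol : ∀ c : ↥K, ∑ p : B4.Idx Ω d, T p c ≤ (L : ℝ) ^ d * L := by
    intro c
    rw [hT]
    dsimp only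
    exact_mod_cast sum_mult_le (L := L) (Ω := Ω) (c : (Fin d → ℤ) × Fin d)
  have hS := sum_sq_le T hT0 (fun c : ↥K => B' c) hL0.le hrow hcol
  have e1 : ∀ p : B4.Idx Ω d, adjQ L K B' p = ((L : ℝ) ^ (d + 1))⁻¹ * ∑ c : ↥K, T p c * B' c := by
    intro p
    unfold adjQ
    rw [hT]
    dsimp only
    rw [Finset.sum_coe_sort K (fun c => (mult L c (p.1 : Fin d → ℤ) p.2 : ℝ) * B' c)]
  have e2 : ∑ c : ↥K, B' (c : (Fin d → ℤ) × Fin d) ^ 2 = ∑ c ∈ K, B' c ^ 2 :=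
    Finset.sum_coe_sort K (fun c => B' c ^ 2)
  calc ∑ p : B4.Idx Ω d, adjQ L K B' p ^ 2
      = ∑ p : B4.Idx Ω d, (((L : ℝ) ^ (d + 1))⁻¹) ^ 2 * (∑ c : ↥K, T p c * B' c) ^ 2 := by
        refine Finset.sum_congr rfl fun p _ => ?_
        rw [e1, mul_pow]
    _ = (((L : ℝ) ^ (d + 1))⁻¹) ^ 2 * ∑ p : B4.Idx Ω d, (∑ c : ↥K, T p c * B' c) ^ 2 := by
        rw [Finset.mul_sum]
    _ ≤ (((L : ℝ) ^ (d + 1))⁻¹) ^ 2 * ((L : ℝ) * ((L : ℝ) ^ d * L) * ∑ c : ↥K, B' c ^ 2) :=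
        mul_le_mul_of_nonneg_left hS (sq_nonneg _)
    _ = ((L : ℝ) ^ d)⁻¹ * ∑ c ∈ K, B' c ^ 2 := by
        rw [e2]
        have hL1 : (L : ℝ) ≠ 0 := hL0.ne'
        field_simp
        ring

end AdjQ

/-! ## §3  B₁ and the p. 248 lower bound -/

section POne

open B6Elimination B6BondElimination

variable {d : ℕ} {L : ℕ} {Ω : Finset (Fin d → ℤ)}

/-- B₁ of p. 248: *"B₁ is equal to Q″*B everywhere except the bonds of ⋃_{y∈Λ′} Ax(y) at which it is equal to 0"*,
with Q″*(F, B′)(b) = 1_E(b)F(b) + w·(Q₁*B′)(b) per (2.112)/(2.119) (E = the bonds of Λ^c carrying the identity part,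
K = the constraint bonds of Λ′, w = L^{(d−2)/2} in print, here any real), and the tree bonds `IsTree L Y` (= the bonds
of ⋃_{y∈Y} Ax(y), `B6BondElimination.isTree_iff`; print Y = Λ′). [cite: Balaban1984PropagatorsII, (2.146) p.248] -/
noncomputable def bOne (L : ℕ) (K : Finset ((Fin d → ℤ) × Fin d)) (Y : Finset (Fin d → ℤ)) (E : Finset (B4.Idx Ω d)) (w : ℝ)
    (F : B4.Idx Ω d → ℝ) (B' : (Fin d → ℤ) × Fin d → ℝ) (p : B4.Idx Ω d) : ℝ :=
  if IsTree L Y p then 0 else (if p ∈ E then F p else 0) + w * adjQ L K B' p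

variable {K : Finset ((Fin d → ℤ) × Fin d)} {Y : Finset (Fin d → ℤ)} {E : Finset (B4.Idx Ω d)}

/-- COARSE HALF: (w/L^d)²·Σ_{c∈K} B′(c)² ≤ ‖B₁‖² — keep only the pivots b₀(c), c ∈ K: they are pairwise distinct
(`eq_of_mult_pivSite_ne_zero`), not tree bonds (`not_isTree_of_piv`), not E-bonds (hypothesis `hEp`; = the repaired
interface convention, header (e) v1.1), and there B₁ = w·L^{−d}B′(c) (`adjQ_piv`). [cite: Balaban1984PropagatorsII,
p.248] -/
theorem coarse_sq_le (hL : 0 < L) (hK : Admissible L Ω K)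
    (hEp : ∀ p ∈ E, ∀ c ∈ K, (p.1 : Fin d → ℤ) = pivSite L c → p.2 ≠ c.2)
    (w : ℝ) (F : B4.Idx Ω d → ℝ) (B' : (Fin d → ℤ) × Fin d → ℝ) :
    (w / (L : ℝ) ^ d) ^ 2 * ∑ c ∈ K, B' c ^ 2 ≤ ∑ p : B4.Idx Ω d, bOne L K Y E w F B' p ^ 2 := by
  have hKdvd : ∀ c ∈ K, ∀ i, (L : ℤ) ∣ c.1 i := fun c hc => (hK c hc).1
  -- the pivot of c as a variable
  let g : ↥K → B4.Idx Ω d := fun c => (⟨pivSite L c.1, (hK c.1 c.2).2⟩, c.1.2)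
  have hg_inj : ∀ x ∈ (Finset.univ : Finset ↥K), ∀ y ∈ (Finset.univ : Finset ↥K), g x = g y → x = y := by
    intro x _ y _ h
    have h1 : pivSite L x.1 = pivSite L y.1 := congrArg (fun q : B4.Idx Ω d => (q.1 : Fin d → ℤ)) h
    have h2 : x.1.2 = y.1.2 := congrArg (fun q : B4.Idx Ω d => q.2) h
    have hm : mult L x.1 (pivSite L y.1) y.1.2 ≠ 0 := by
      rw [← h1, ← h2, mult_pivSite hL]
      exact hL.ne'
    exact Subtype.ext (eq_of_mult_pivSite_ne_zero hL (hKdvd x.1 x.2) (hKdvd y.1 y.2) hm).symm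
  have hval : ∀ c : ↥K, bOne L K Y E w F B' (g c) = w / (L : ℝ) ^ d * B' c.1 := by
    intro c
    have hnt : ¬ IsTree L Y (g c) := not_isTree_of_piv hL (hKdvd c.1 c.2) (g c) rfl rfl
    have hnE : g c ∉ E := fun h => hEp (g c) h c.1 c.2 rfl rfl
    unfold bOne
    rw [if_neg hnt, if_neg hnE, zero_add, adjQ_piv hL hKdvd B' c.2 (g c) rfl rfl, div_eq_mul_inv, mul_assoc]
  calc (w / (L : ℝ) ^ d) ^ 2 * ∑ c ∈ K, B' c ^ 2
      = ∑ c : ↥K, (w / (L : ℝ) ^ d * B' c.1) ^ 2 := by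
        rw [← Finset.sum_coe_sort K (fun c => B' c ^ 2), Finset.mul_sum]
        refine Finset.sum_congr rfl fun c _ => ?_
        ring
    _ = ∑ c : ↥K, bOne L K Y E w F B' (g c) ^ 2 := Finset.sum_congr rfl fun c _ => by rw [hval]
    _ = ∑ p ∈ (Finset.univ : Finset ↥K).image g, bOne L K Y E w F B' p ^ 2 := (Finset.sum_image (f := fun p => bOne L K Y E w F B' p ^ 2) hg_inj).symm
    _ ≤ ∑ p : B4.Idx Ω d, bOne L K Y E w F B' p ^ 2 :=
        Finset.sum_le_sum_of_subset_of_nonneg (Finset.subset_univ _) fun p _ _ => sq_nonneg _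

/-- IDENTITY HALF: Σ_{b∈E} F(b)² ≤ 2‖B₁‖² + 2w²L^{−d}·Σ_{c∈K} B′(c)² — on an E-bond (never a tree bond) F = B₁ −
w·Q₁*B′, and ‖Q₁*B′‖² ≤ L^{−d}‖B′‖² (`sum_adjQ_sq_le`). [cite: Balaban1984PropagatorsII, p.248] -/
theorem ident_sq_le (hL : 0 < L) (hK : ∀ c ∈ K, ∀ i, (L : ℤ) ∣ c.1 i) (hEt : ∀ p ∈ E, ¬ IsTree L Y p)
    (w : ℝ) (F : B4.Idx Ω d → ℝ) (B' : (Fin d → ℤ) × Fin d → ℝ) :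
    ∑ p ∈ E, F p ^ 2 ≤ 2 * ∑ p : B4.Idx Ω d, bOne L K Y E w F B' p ^ 2
      + 2 * w ^ 2 * (((L : ℝ) ^ d)⁻¹ * ∑ c ∈ K, B' c ^ 2) := by
  have h1 : ∀ p ∈ E, F p ^ 2 ≤ 2 * bOne L K Y E w F B' p ^ 2 + 2 * w ^ 2 * adjQ L K B' p ^ 2 := by
    intro p hp
    have e : F p = bOne L K Y E w F B' p - w * adjQ L K B' p := by
      unfold bOne
      rw [if_neg (hEt p hp), if_pos hp, add_sub_cancel_right]
    rw [e]
    nlinarith [sq_nonneg (bOne L K Y E w F B' p + w * adjQ L K B' p)]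
  calc ∑ p ∈ E, F p ^ 2
      ≤ ∑ p ∈ E, (2 * bOne L K Y E w F B' p ^ 2 + 2 * w ^ 2 * adjQ L K B' p ^ 2) := Finset.sum_le_sum h1
    _ ≤ ∑ p : B4.Idx Ω d, (2 * bOne L K Y E w F B' p ^ 2 + 2 * w ^ 2 * adjQ L K B' p ^ 2) :=
        Finset.sum_le_sum_of_subset_of_nonneg (Finset.subset_univ _) fun p _ _ => by positivity
    _ = 2 * ∑ p : B4.Idx Ω d, bOne L K Y E w F B' p ^ 2 + 2 * w ^ 2 * ∑ p : B4.Idx Ω d, adjQ L K B' p ^ 2 := by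
        rw [Finset.sum_add_distrib, ← Finset.mul_sum, ← Finset.mul_sum]
    _ ≤ 2 * ∑ p : B4.Idx Ω d, bOne L K Y E w F B' p ^ 2
          + 2 * w ^ 2 * (((L : ℝ) ^ d)⁻¹ * ∑ c ∈ K, B' c ^ 2) := by
        have := sum_adjQ_sq_le (Ω := Ω) hL hK B'
        nlinarith [sq_nonneg w]

/-- **THE p. 248 STEP** *"‖B₁‖² is bounded from below by const‖B‖²"*, PROVED with an explicit constant depending on d
and L only (and on the weight w of the coarse component of Q″; w² = L^{d−2} in print), uniformly in the region Ω, the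
identity bonds E (print: Λ^c), the constraint bonds K (print: Λ′) and the axial trees Y (print: Λ′):
‖F↾_E‖² + ‖B′↾_K‖² ≤ (2 + 2L^d + L^{2d}/w²)·‖B₁‖².  Hypotheses: K admissible, no E-bond is a tree bond (`hEt`) or a
pivot (`hEp`) — the printed geometry with E = the unit bonds having BOTH end-points in Λ^c (repaired interface
convention, header (e) v1.1; under the printed p. 224 convention the pivots of the constraint bonds with exactly one
end-point in Λ′ are E-bonds and `hEp` fails). [cite: Balaban1984PropagatorsII, (2.146)–(2.147) p.248] -/
theorem p248_lower (hL : 0 < L) (hK : Admissible L Ω K) (hEt : ∀ p ∈ E, ¬ IsTree L Y p)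
    (hEp : ∀ p ∈ E, ∀ c ∈ K, (p.1 : Fin d → ℤ) = pivSite L c → p.2 ≠ c.2) {w : ℝ} (hw : w ≠ 0)
    (F : B4.Idx Ω d → ℝ) (B' : (Fin d → ℤ) × Fin d → ℝ) :
    ∑ p ∈ E, F p ^ 2 + ∑ c ∈ K, B' c ^ 2
      ≤ (2 + 2 * (L : ℝ) ^ d + (L : ℝ) ^ (2 * d) / w ^ 2) * ∑ p : B4.Idx Ω d, bOne L K Y E w F B' p ^ 2 := by
  have hKdvd : ∀ c ∈ K, ∀ i, (L : ℤ) ∣ c.1 i := fun c hc => (hK c hc).1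
  have hL0 : (0 : ℝ) < L := by exact_mod_cast hL
  have hLd : (0 : ℝ) < (L : ℝ) ^ d := pow_pos hL0 d
  have hc := coarse_sq_le (Y := Y) hL hK hEp w F B'
  have hi := ident_sq_le (E := E) (Y := Y) hL hKdvd hEt w F B'
  set S := ∑ p : B4.Idx Ω d, bOne L K Y E w F B' p ^ 2 with hS
  set X := ∑ c ∈ K, B' c ^ 2 with hX
  have hS0 : 0 ≤ S := Finset.sum_nonneg fun p _ => sq_nonneg _
  have hX0 : 0 ≤ X := Finset.sum_nonneg fun c _ => sq_nonneg _
  have hw2 : 0 < w ^ 2 := by positivity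
  have hL2d : (0 : ℝ) < (L : ℝ) ^ (2 * d) := pow_pos hL0 _
  have e2d : ((L : ℝ) ^ d) ^ 2 = (L : ℝ) ^ (2 * d) := by rw [← pow_mul, mul_comm]
  -- X ≤ L^{2d}/w² · S
  have hX1 : X ≤ (L : ℝ) ^ (2 * d) / w ^ 2 * S := by
    have e : (w / (L : ℝ) ^ d) ^ 2 = w ^ 2 / (L : ℝ) ^ (2 * d) := by rw [div_pow, e2d]
    rw [e, div_mul_eq_mul_div, div_le_iff₀ hL2d] at hc
    rw [div_mul_eq_mul_div, le_div_iff₀ hw2]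
    linarith
  -- Σ_E F² ≤ 2S + 2 L^d S
  have hF : ∑ p ∈ E, F p ^ 2 ≤ 2 * S + 2 * (L : ℝ) ^ d * S := by
    have h3 : w ^ 2 * (((L : ℝ) ^ d)⁻¹ * X) ≤ (L : ℝ) ^ d * S := by
      calc w ^ 2 * (((L : ℝ) ^ d)⁻¹ * X)
          ≤ w ^ 2 * (((L : ℝ) ^ d)⁻¹ * ((L : ℝ) ^ (2 * d) / w ^ 2 * S)) := by gcongr
        _ = (L : ℝ) ^ d * S := by
            have hw1 : w ≠ 0 := hw
            have hL1 : (L : ℝ) ^ d ≠ 0 := hLd.ne'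
            rw [← e2d]
            field_simp
    linarith
  calc ∑ p ∈ E, F p ^ 2 + X ≤ (2 * S + 2 * (L : ℝ) ^ d * S) + (L : ℝ) ^ (2 * d) / w ^ 2 * S := add_le_add hF hX1
    _ = (2 + 2 * (L : ℝ) ^ d + (L : ℝ) ^ (2 * d) / w ^ 2) * S := by ring

end POne

end Literature.MathematicalPhysics.QuantumFieldTheory.Balaban1983to89.B6AdjointAveraging
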